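import Summits.AtomisticToContinuum.FouriersLaw.Theorems.VanishingNoiseTransferNoiseLocalityStubUniformConductanceFloor
import Summits.AtomisticToContinuum.FouriersLaw.Theorems.OddSectorIrreversibilityBoundedResponseConvergesStubPositiveConductance
import Summits.AtomisticToContinuum.FouriersLaw.Theorems.VanishingNoiseTransferNoiseLocalityStubResponseDensityNoisy
import Summits.AtomisticToContinuum.FouriersLaw.Theorems.VanishingNoiseTransferNoiseLocalityStubNoisyPositive
import Literature.MathematicalPhysics.KineticTheory.VelocityFlipNoise

/-!
# Stub `stub_positiveNoisyConductance` of crux `NoiseLocality` (line `fekete-transposed-uniformity`)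

Crux `VanishingNoiseTransfer.NoiseLocality` (stmt-AtomisticToContinuum-11975), line
`fekete-transposed-uniformity`, registered stub 3: for the pinned anharmonic chain `pinnedChain ω₂ lam β γ`
(`ω₂, lam, β, γ > 0`), every length `N ≥ 2`, every flip rate `ε ∈ [0,1]`, every `T > 0`, every per-`N`
family `μ` of weak steady states of `L + εS` that is UNIQUE at all bath temperatures `T_L, T_R > 0`, and every
response coefficient `D = lim_{δ → 0, δ ≠ 0} totalCurrent(μ (T+δ/2) (T-δ/2))/δ`: `0 < D` (so that
`R_N(ε) = (N-1)/D_N(ε)` is a resistance). Pure plumbing of two landed slices: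

* `ε > 0`: the landed fixed-`N` stubs of the sibling line `relative-flip-energy-transfer`, in exactly this
  shape: a response density `U` of the unique rate-`ε` family (`stub_responseDensityNoisy`) and strict
  positivity of the response (`stub_noisyPositive`).
* `ε = 0`: `IsFlipSteadyState N T_L T_R 0 μ ↔ IsSteadyState N T_L T_R μ` (`isFlipSteadyState_zero_iff`), so
  `μ` is the unique deterministic weak steady family of the `N`-chain. Item stmt-AtomisticToContinuum-11750
  `PositiveConductance` is proved (`positiveConductance_holds`) for GLOBAL steady families under weak-NESS
  uniqueness (`NessUnique_holds`, stmt-0741): take the reference family with its response sequence `D'`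
  from `StubUniformConductanceFloor.exists_steadyFamily_responseCoeff`, get `0 < D' N`, and identify
  `D = D' N` — the per-`N` family agrees with the reference one for `|δ| < T` by uniqueness
  (`StubUniformConductanceFloor.tendsto_responseQuotient_iff`), and limits along `𝓝[≠] 0` are unique.

No definitions.
-/

noncomputable section

namespace Summit.AtomisticToContinuum.FouriersLaw.Theorems.NoiseLocality

open MeasureTheory Filter Topology
open Literature.MathematicalPhysics.KineticTheory.HeatConduction

/-- **Stub 3 of line `fekete-transposed-uniformity` (fixed-`N` positivity of the noisy conductance on the
closed noise interval).** For `pinnedChain ω₂ lam β γ` (all parameters `> 0`), `N ≥ 2`, `ε ∈ [0,1]`, `T > 0`,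
every per-`N` unique family `μ` of weak steady states of `L + εS` and every response coefficient `D` of it at
`T`: `0 < D`. `ε > 0`: `stub_responseDensityNoisy` + `stub_noisyPositive`; `ε = 0`: item stmt-11750
(`positiveConductance_holds`) along a global reference steady family (`exists_steadyFamily_responseCoeff`,
uniqueness premise `NessUnique_holds`), transported to `μ` by uniqueness near `δ = 0`
(`tendsto_responseQuotient_iff`, `tendsto_nhds_unique`). [cite: BernardinOlla2011, Prop 1] -/
theorem stub_positiveNoisyConductance :
    ∀ ω₂ lam β γ : ℝ, 0 < ω₂ → 0 < lam → 0 < β → 0 < γ →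
    ∀ (N : ℕ), 2 ≤ N → ∀ ε : ℝ, 0 ≤ ε → ε ≤ 1 → ∀ T : ℝ, 0 < T →
    ∀ μ : ℝ → ℝ →
        MeasureTheory.Measure (Literature.MathematicalPhysics.KineticTheory.HeatConduction.PhaseSpace N),
      (∀ T_L T_R : ℝ, 0 < T_L → 0 < T_R →
        (Literature.MathematicalPhysics.KineticTheory.HeatConduction.pinnedChain ω₂ lam β γ).IsFlipSteadyState
            N T_L T_R ε (μ T_L T_R) ∧
          ∀ ν : MeasureTheory.Measure (Literature.MathematicalPhysics.KineticTheory.HeatConduction.PhaseSpace N),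
            (Literature.MathematicalPhysics.KineticTheory.HeatConduction.pinnedChain ω₂ lam β γ).IsFlipSteadyState
              N T_L T_R ε ν → ν = μ T_L T_R) →
      ∀ D : ℝ, Filter.Tendsto (fun δ : ℝ =>
          (Literature.MathematicalPhysics.KineticTheory.HeatConduction.pinnedChain ω₂ lam β γ).totalCurrent
            (μ (T + δ / 2) (T - δ / 2)) / δ) (nhdsWithin 0 {(0 : ℝ)}ᶜ) (nhds D) → 0 < D := by
  intro ω₂ lam β γ hω hl hβ hγ N hN ε hε0 _hε1 T hT μ hμ D hD
  rcases hε0.lt_or_eq with hε | hε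
  · -- positive rate: response density of the unique rate-`ε` family, then strict positivity (landed stubs)
    obtain ⟨U, hU⟩ := stub_responseDensityNoisy ω₂ lam β γ hω hl hβ hγ T hT N ε hε μ hμ
    exact stub_noisyPositive ω₂ lam β γ hω hl hβ hγ T hT N hN ε hε μ hμ U hU D hD
  · -- rate `0`: the deterministic chain
    subst hε
    set P := pinnedChain ω₂ lam β γ
    -- `μ` is the unique deterministic weak steady family of the `N`-chain
    have hμ0 : ∀ T_L T_R : ℝ, 0 < T_L → 0 < T_R → P.IsSteadyState N T_L T_R (μ T_L T_R) ∧
        ∀ ν : Measure (PhaseSpace N), P.IsSteadyState N T_L T_R ν → ν = μ T_L T_R := by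
      intro T_L T_R hL hR
      obtain ⟨h1, h2⟩ := hμ T_L T_R hL hR
      exact ⟨(P.isFlipSteadyState_zero_iff N T_L T_R _).1 h1, fun ν hν =>
        h2 ν ((P.isFlipSteadyState_zero_iff N T_L T_R ν).2 hν)⟩
    -- weak-NESS uniqueness (stmt-0741) and a global reference steady family with its response sequence
    have huniq : ∀ (M : ℕ) (T_L T_R : ℝ), 0 < T_L → 0 < T_R →
        ∀ μ' ν : Measure (PhaseSpace M), P.IsSteadyState M T_L T_R μ' → P.IsSteadyState M T_L T_R ν → μ' = ν :=
      Summit.AtomisticToContinuum.FouriersLaw.Theses.VanishingNoiseTransfer.NessUnique_holds ω₂ lam β γ hω hl hβ hγ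
    obtain ⟨μref, hμref, D', hD'⟩ :=
      StubUniformConductanceFloor.exists_steadyFamily_responseCoeff (ω₂ := ω₂) (lam := lam) (β := β) (γ := γ)
        hω hl hβ hγ hT
    -- item stmt-11750 along the reference family
    have hpos : 0 < D' N :=
      Summit.AtomisticToContinuum.FouriersLaw.Cruxes.BoundedResponseConverges.TwoScaleGluingLogRigidity.Stubs.positiveConductance_holds
        ω₂ lam β γ hω hl hβ hγ huniq μref hμref T hT D' hD' N hN
    -- `D` is a response coefficient of `μref N` as well (the families agree for `|δ| < T`), so `D = D' N`
    have hD2 : Tendsto (fun δ : ℝ => P.totalCurrent (μref N (T + δ / 2) (T - δ / 2)) / δ) (𝓝[≠] 0) (𝓝 D) :=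
      (StubUniformConductanceFloor.tendsto_responseQuotient_iff P hT μ (μref N) hμ0 (hμref N) D).mp hD
    rw [tendsto_nhds_unique hD2 (hD' N)]
    exact hpos

end Summit.AtomisticToContinuum.FouriersLaw.Theorems.NoiseLocality

end
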